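import Literature.NumberTheory.ComplexMultiplication.CosetGermGaloisDiagram
import Literature.NumberTheory.ComplexMultiplication.CosetGermPairProductSquare
import HarnessLib

/-!
# Milne 1999 §6 p. 69 L22–L28 in the Galois coordinates — CM types on `K` = CM types on `Γ` (`λ_Φ ↦ Σ_{σ∈Φ} σ`, `ψ_i = λ_{Φ_i}`,
# orbits `Ψ` correspond), `f_{π(Φ)}` = the model's Weil germ of `Φ`; and THEOREM 6.1 at level `K` on characters with
# `X^*(S^K)`, `X^*(P^K)`, `X^*(α^K)` those of the CM field `K`
# (J. S. Milne, *Lefschetz motives and the Tate conjecture*, Compositio Math. 117 (1999), §6 p. 69 L22–L28, p. 66 Thm. 6.1, pp. 71–72)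

Family `hodge`, lane `lit-hodgefound` (Layer A3; seat `lit-hodgefound-p27`, generation 18, row g18-#3); topic
`Literature/NumberTheory/ComplexMultiplication`, namespace `Literature.NumberTheory.ComplexMultiplication.CMNumbers`.  Third file of the
dictionary g18-#1 (`Γ = Gal(K/ℚ)`, `ι = conjGal`, `D(w₀)`, `Γ/D ≅ Y`, the number-theoretic `CosetGerm.Setting`) / g18-#2 (`X^*(S^K) ↪ ℤ[Γ] ≅
serreLattice`, `X^*(P^K) → ℤ[Γ/D] ≅ weilLattice`, `X^*(α^K) = alphaP`) between the NUMBER-THEORETIC side of the seat's Milne-1999 series (g15/g16: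
CM types `Φ ⊂ Hom(K, ℚ^{cm})` with skel-3's `IsCMTypeWith`, `λ_Φ = cmTypeChar`, `π(Φ) = cmTypeGerm`, `X^*(S^K) = infinityTypes`, `X^*(P^K) =
W^K(p^∞) = weilLimitIn`, `X^*(α^K) = alphaCharIn`) and the GROUP-RING MODEL of g17 (`CosetGerm.CMTypes h` = CM types on `Γ`, `ind`, `psi`,
`psiType`, `WeilGerms`/`red`, `TK`, `LK`, `alphaK`, `tKToS`, `lKToP`, `exact_pairProduct`).  Small carriers with bodies (`typeFinset`,
`toCMTypes`, `ofCMTypes`) + THEOREMS; no named fact (D-0026, net debt 0).  Nothing here is a case of the Hodge conjecture or of Tate's.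

THE PRINT.  [Milne1999] §6 p. 69 L22–L28 (held `paper:doi-10-1023-a-1000776613765` p0025 L55–L84), verbatim: «Let `ψ_i = τ_i + Σ_{j≠i} ιτ_j`,
`ψ̄ = Σ ιτ_i`.  Then `ψ₀, …, ψ_{n−1}, ψ̄` form a basis for `X^*(S^K)` (Lemma 3.3). As `τ_iψ₀ = ψ_i`, `(ιτ_i)ψ₀ = ιψ_i` we see that
`Ψ =_{df} {ψ₀, …, ψ_{n−1}, ιψ₀, …, ιψ_{n−1}}` is a `Γ`-orbit in `X^*(S^K)`.  Let `π_i = π(ψ_{id}) ∈ W^K_{1,+}(p^∞)`. Then `Π =_{df} {π₀, …, π_{(n/d)−1},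
ιπ₀, …, ιπ_{(n/d)−1}}` is a `Γ`-orbit in `X^*(P^K)`.»  p. 71 L15 «`I = Γ\{CM-types on K}`, `I′ = Γ\W^K_{1,+}(p^∞)`»; §5 p. 64 L-4 – p. 65 L1
«`f ↦ π(f) : X^*(S^K) → W^K(p^∞)` which sends CM-types on `K` to Weil integers of weight `−1` … to each `Γ`-orbit `Ψ` of CM-types it attaches a
`Γ`-orbit `Π(Ψ)`».  THEOREM 6.1 (p. 66 L3–L4, L13–L17): «identifies `P` with `L ∩ S` (intersection in `T`) … we shall show that `P^K = S^K ∩ L^K`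
(inside `T^K`), or, equivalently, that `P^K −(β^K, −α^K)→ L^K × S^K −(α′^K γ^K)→ T^K` is exact, for all sufficiently large `K ⊂ ℚ^{cm}`»; p. 68 L-2 –
p. 69 L9: proved for `K ⊇ Q` imaginary quadratic with `(p)` split, `Γ = Γ₀ × ⟨ι⟩`, `D = D(w₀) ⊂ Γ₀`; pp. 71–72: «Therefore the right hand square is
almost Cartesian, which completes the proof of Theorem 6.1.»

DICTIONARY.  As in g18-#1/#2 (`K` CM Galois over `ℚ`, `τ₀ : K →ₐ[ℚ] ℚ^{cm}`, `Γ = K ≃ₐ[ℚ] K`, `Hom(K, ℚ^{al}) = τ₀Γ` via `embOfAut`/`autEquivEmb`,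
`ι_{cm} ∘ τ₀σ = τ₀ ∘ ισ`).  A CM type OF `K` is a `Φ : Set (K →ₐ[ℚ] ℚ^{cm})` with `IsCMTypeWith ι_{cm} Φ` (g16-#6; `λ_Φ = cmTypeChar`, `π(Φ) =
cmTypeGerm p 𝔭`, `Gal(ℚ^{cm}/ℚ)` acting on `Set` pointwise); a CM type ON `Γ` for a `Setting h` is an element of g17-#4's `CosetGerm.CMTypes h` (finite
`S ⊂ Γ` with `x ∈ S ⟺ ιx ∉ S`, `Γ` acting by left translation; `ind R h S = Σ_{x∈S} x ∈ ℤ[Γ]`, `red R h S = push(ind S) ∈ WeilGerms R h ⊂ ℤ[Γ/D]`).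
«`Φ` read on `Γ`» = `typeFinset τ₀ Φ = {σ | τ₀σ ∈ Φ}`, `toCMTypes τ₀ h : (CM types of K) → CMTypes h`, inverse `ofCMTypes τ₀ h S = {x | τ₀⁻¹x ∈ S}`;
Milne's `ψ_i` = g17-#2 `CosetGerm.psi ι Γ₀ R τ_i` = `ind (τ_i • psiType h)` (g17-#4), his CM type `Φ_i = {τ_i} ∪ {ιτ_j | j ≠ i}` = `ofCMTypes (τ_i •
psiType h)`; `π_i = π(ψ_{id})` = `alphaCharIn (cmTypeChar _)`, its `f_π` on `Γ/D` = g18-#2 `germToCosetFun`.  THEOREM 6.1 at level `K` on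
characters = g17-#5 `exact_pairProduct` for the `Setting` `cosetGermSetting Q p 𝔭` of g18-#1, with its `S`- and `P`-vertices replaced by the CM
field's `X^*(S^K) = infinityTypes`, `X^*(P^K) = Additive (weilLimitIn K p τ₀)` and `X^*(α^K) = alphaCharIn` through g18-#2's `serreLatticeEquiv`,
`weilLatticeEquiv`, `weilLatticeEquiv_alphaCharIn` (the `T`- and `L`-vertices stay g17-#5's amalgamated products `TK`, `LK` over the orbit sets
`I`, `I′` of the model — which by `toCMTypes_mem_orbit_iff` / `exists_cmTypeChar_of_weilGerms` are the orbit sets of the CM types of `K` and of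
their Weil germs `π(Φ) ∈ W^K_{1,+}(p^∞)`).

WHAT IS HERE (all PROVED):
* §1 DEF `typeFinset` (`mem_typeFinset_iff`), `isCMTypeFor_typeFinset`, DEF **`toCMTypes`** (`mem_toCMTypes_iff`), **`toGroupRing_cmTypeChar`** (`λ_Φ ↦
  ind(Φ read on Γ)` under g18-#2's `X^*(S^K) ↪ ℤ[Γ]`), `coe_serreLatticeEquiv_cmTypeChar`, DEF **`ofCMTypes`** (`embOfAut_mem_ofCMTypes_iff`,
  **`isCMTypeWith_ofCMTypes`**, `toCMTypes_ofCMTypes`, `ofCMTypes_toCMTypes`, `toCMTypes_injective` — a bijection CM types of `K` ≅ CM types on `Γ`),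
  `exists_smul_eq_embOfAut(')` (restriction `Gal(ℚ^{cm}/ℚ) ↠ Γ` along `τ₀`), **`toCMTypes_smul_set`** (equivariance: `σ′Φ ↦ ρ·(Φ on Γ)` when
  `σ′τ₀ = τ₀ρ`), **`toCMTypes_mem_orbit_iff`** («`Γ`-orbits of CM-types» correspond), `toGroupRing_cmTypeChar_ofCMTypes`,
  **`toGroupRing_cmTypeChar_psiType`** («`ψ_i = τ_i + Σ_{j≠i} ιτ_j`» IS `λ_{Φ_i}` of the CM type `Φ_i` of `K`).
* §2 `coe_toMul_alphaCharIn_cmTypeChar` (`π(Φ)`'s germ is `cmTypeGerm`), **`coe_red_toCMTypes`** (`red(Φ on Γ) = f_{π(Φ)}` on `Γ/D` — «`π_i = π(ψ_{id}) ∈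
  W^K_{1,+}(p^∞)`» read in the model), `coe_weilLatticeEquiv_alphaCharIn_cmTypeChar`, **`exists_cmTypeChar_of_weilGerms`** (every model Weil germ is an
  `f_{π(Φ)}`, `Φ` a CM type of `K`).
* §3 **`int_isAlmostCartesian_pairProduct_gal`** («the right hand square is almost Cartesian» for `Γ = Gal(K/ℚ) ⊇ Gal(K/Q) ⊇ D(w₀)` of g18-#1),
  **`exact_pairProduct_gal`** — THEOREM 6.1 AT LEVEL `K` ON CHARACTERS FOR THE CM FIELD `K`: for `y ∈ X^*(L^K)` and `g ∈ X^*(S^K) = infinityTypes`,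
  `β(y) = X^*(α^K)(g)` in `X^*(P^K) = W^K(p^∞)` iff `(y, g)` comes from an `x ∈ X^*(T^K)`.

NOT here: the `T`/`L` vertices as character modules of tori built from the CM types of `K` themselves (g16-#6/#7 `cmOrbitChar`, `weilOrbitChar` per
orbit; their products over `I`, `I′` and the maps `γ^K`, `β^K`, `α′^K` assembled over all orbits are only in the model, g17-#5); THEOREM 6.1 for the
group schemes `P`, `L`, `S`, `T` and the limit over `K` (Layer B, B5-09); Prop. 5.3 / Thm. 5.4 (Shimura–Taniyama).

## References

* [Milne1999] J. S. Milne, *Lefschetz motives and the Tate conjecture*, Compositio Math. 117 (1999) 45–76 — §6 p. 69 L22–L28, p. 71 L15, p. 66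
  Theorem 6.1, pp. 71–72; §5 pp. 64–65 (held `paper:doi-10-1023-a-1000776613765` p0025, p0027–p0028, p0022, p0020–p0021).

Provenance: lane `lit-hodgefound`, seat `lit-hodgefound-p27` gen 18 (agent `literature-prover-lit-hodgefound-p27-g18-0`), row g18-#3.
-/

set_option autoImplicit false

noncomputable section

open scoped NumberField Pointwise

namespace Literature.NumberTheory.ComplexMultiplication

namespace CMNumbers

open _root_.NumberField IntermediateField Finset
open Literature.NumberTheory.NumberFields (cmNumbers cmNumbersConj cmNumbersConj_mul_self cmNumbersConj_comm)
open Literature.AlgebraicGeometry.Deligne1982 (IsCMTypeFor)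
open OrbitTorus (pushFun)
open CosetGerm (Setting CMTypes ind serreLattice weilLattice alphaP WeilGerms red)

/-! ### §1 CM types on `Hom(K, ℚ^{cm})` and CM types on `Γ` -/

section Types

variable {K : Type} [Field K] [NumberField K] [IsCMField K] [IsGalois ℚ K] (τ₀ : K →ₐ[ℚ] cmNumbers)
variable {Γ₀ D : Subgroup (K ≃ₐ[ℚ] K)} (h : Setting (conjGal : K ≃ₐ[ℚ] K) Γ₀ D)

/-- **A set `Φ ⊂ Hom(K, ℚ^{cm})` read on `Γ`**: `{σ ∈ Γ | τ₀σ ∈ Φ}` (Milne's identification `Hom(K, ℚ^{al}) = Γ`). [cite: Milne1999, §6 p. 69 L22–L24;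
§2 p. 55 («CM-types on K»)] -/
def typeFinset (Φ : Set (K →ₐ[ℚ] cmNumbers)) : Finset (K ≃ₐ[ℚ] K) := by
  classical exact univ.filter fun σ => embOfAut τ₀ σ ∈ Φ

omit [IsCMField K] [IsGalois ℚ K] in
/-- [cite: Milne1999, §6 p. 69 L22–L24] -/
@[simp] theorem mem_typeFinset_iff (Φ : Set (K →ₐ[ℚ] cmNumbers)) (σ : K ≃ₐ[ℚ] K) : σ ∈ typeFinset τ₀ Φ ↔ embOfAut τ₀ σ ∈ Φ := by
  classical
  simp [typeFinset]

omit [IsGalois ℚ K] in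
/-- A CM type `Φ` of `K` (`x ∈ Φ ⟺ ι_{cm}x ∉ Φ`, skel-3's `IsCMTypeWith`) read on `Γ` is a CM type for `x ↦ ιx` (`σ ∈ Φ ⟺ ισ ∉ Φ`, the lane's
`Deligne1982.IsCMTypeFor`), because `ι_{cm} ∘ τ₀σ = τ₀ ∘ ισ`. [cite: Milne1999, §6 p. 69 L22–L24; §2 p. 55] -/
theorem isCMTypeFor_typeFinset {Φ : Set (K →ₐ[ℚ] cmNumbers)} (hΦ : IsCMTypeWith (cmNumbersConj : cmNumbers ≃ₐ[ℚ] cmNumbers) Φ) :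
    IsCMTypeFor (fun x : K ≃ₐ[ℚ] K => conjGal * x) (typeFinset τ₀ Φ) := by
  intro σ
  rw [mem_typeFinset_iff, mem_typeFinset_iff, ← cmNumbersConj_smul_embOfAut]
  exact hΦ.mem_iff _

/-- **CM types of `K` ↦ CM types on `Γ`** (g17-#4's `CosetGerm.CMTypes h`). [cite: Milne1999, §6 p. 69 L22–L24, p. 71 L15 («Γ\\{CM-types on K}»)] -/
def toCMTypes {Φ : Set (K →ₐ[ℚ] cmNumbers)} (hΦ : IsCMTypeWith (cmNumbersConj : cmNumbers ≃ₐ[ℚ] cmNumbers) Φ) : CMTypes h :=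
  ⟨typeFinset τ₀ Φ, isCMTypeFor_typeFinset τ₀ hΦ⟩

omit [IsGalois ℚ K] in
/-- [cite: Milne1999, §6 p. 69 L22–L24] -/
@[simp] theorem mem_toCMTypes_iff {Φ : Set (K →ₐ[ℚ] cmNumbers)} (hΦ : IsCMTypeWith (cmNumbersConj : cmNumbers ≃ₐ[ℚ] cmNumbers) Φ)
    (σ : K ≃ₐ[ℚ] K) : σ ∈ (toCMTypes τ₀ h hΦ).1 ↔ embOfAut τ₀ σ ∈ Φ :=
  mem_typeFinset_iff τ₀ Φ σ

omit [IsGalois ℚ K] in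
/-- **`λ_Φ ↦ Σ_{σ ∈ Φ} σ`**: under `X^*(S^K) ↪ ℤ[Γ]` (g18-#2 `toGroupRing`) the character `λ_Φ` of a CM type (g16-#6 `cmTypeChar`) is the indicator
`ind` of the CM type read on `Γ` (g17-#4). [cite: Milne1999, §6 p. 69 L22–L24 («ψ_i = τ_i + Σ_{j≠i} ιτ_j»)] -/
theorem toGroupRing_cmTypeChar {Φ : Set (K →ₐ[ℚ] cmNumbers)} (hΦ : IsCMTypeWith (cmNumbersConj : cmNumbers ≃ₐ[ℚ] cmNumbers) Φ) :
    toGroupRing τ₀ (cmTypeChar hΦ : (K →ₐ[ℚ] cmNumbers) → ℤ) = ind ℤ h (toCMTypes τ₀ h hΦ) := by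
  classical
  ext σ
  rw [toGroupRing_apply, CosetGerm.ind_apply]
  by_cases hσ : embOfAut τ₀ σ ∈ Φ
  · rw [if_pos ((mem_toCMTypes_iff τ₀ h hΦ σ).2 hσ), cmTypeChar_apply_of_mem hΦ hσ]
  · rw [if_neg (fun h' => hσ ((mem_toCMTypes_iff τ₀ h hΦ σ).1 h')), cmTypeChar_apply_of_notMem hΦ hσ]

/-- The same through `X^*(S^K) ≅ serreLattice` (g18-#2 `serreLatticeEquiv`). [cite: Milne1999, §6 p. 69 L22–L24] -/
theorem coe_serreLatticeEquiv_cmTypeChar {Φ : Set (K →ₐ[ℚ] cmNumbers)} (hΦ : IsCMTypeWith (cmNumbersConj : cmNumbers ≃ₐ[ℚ] cmNumbers) Φ) :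
    (serreLatticeEquiv τ₀ (cmTypeChar hΦ) : (K ≃ₐ[ℚ] K) →₀ ℤ) = ind ℤ h (toCMTypes τ₀ h hΦ) := by
  rw [coe_serreLatticeEquiv, toGroupRing_cmTypeChar]

/-- **CM types on `Γ` ↦ CM types of `K`**: `S ↦ {x | τ₀⁻¹x ∈ S}`. [cite: Milne1999, §6 p. 69 L22–L24] -/
def ofCMTypes (S : CMTypes h) : Set (K →ₐ[ℚ] cmNumbers) := {x | (autEquivEmb τ₀).symm x ∈ S.1}

/-- [cite: Milne1999, §6 p. 69 L22–L24] -/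
@[simp] theorem embOfAut_mem_ofCMTypes_iff (S : CMTypes h) (σ : K ≃ₐ[ℚ] K) : embOfAut τ₀ σ ∈ ofCMTypes τ₀ h S ↔ σ ∈ S.1 := by
  change (autEquivEmb τ₀).symm (embOfAut τ₀ σ) ∈ S.1 ↔ _
  rw [← autEquivEmb_apply, Equiv.symm_apply_apply]

/-- `{x | τ₀⁻¹x ∈ S}` is a CM type of `K` for a CM type `S` on `Γ`. [cite: Milne1999, §6 p. 69 L22–L24; §2 p. 55] -/
theorem isCMTypeWith_ofCMTypes (S : CMTypes h) : IsCMTypeWith (cmNumbersConj : cmNumbers ≃ₐ[ℚ] cmNumbers) (ofCMTypes τ₀ h S) where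
  mem_iff x := by
    obtain ⟨σ, rfl⟩ := (autEquivEmb τ₀).surjective x
    rw [autEquivEmb_apply, cmNumbersConj_smul_embOfAut, embOfAut_mem_ofCMTypes_iff, embOfAut_mem_ofCMTypes_iff]
    exact CosetGerm.CMTypes.mem_iff h S σ
  comm σ x := AlgHom.ext fun y => by simp only [algEquiv_smul_apply]; exact cmNumbersConj_comm σ (x y)
  invol x := by rw [smul_smul, cmNumbersConj_mul_self, one_smul]

/-- The two readings are inverse to each other (`σ ↦ τ₀σ` is a bijection). [cite: Milne1999, §6 p. 69 L22–L24] -/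
@[simp] theorem toCMTypes_ofCMTypes (S : CMTypes h) : toCMTypes τ₀ h (isCMTypeWith_ofCMTypes τ₀ h S) = S :=
  CosetGerm.CMTypes.ext h (Finset.ext fun σ => by rw [mem_toCMTypes_iff, embOfAut_mem_ofCMTypes_iff])

/-- [cite: Milne1999, §6 p. 69 L22–L24] -/
@[simp] theorem ofCMTypes_toCMTypes {Φ : Set (K →ₐ[ℚ] cmNumbers)} (hΦ : IsCMTypeWith (cmNumbersConj : cmNumbers ≃ₐ[ℚ] cmNumbers) Φ) :
    ofCMTypes τ₀ h (toCMTypes τ₀ h hΦ) = Φ := by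
  ext x
  obtain ⟨σ, rfl⟩ := (autEquivEmb τ₀).surjective x
  rw [autEquivEmb_apply, embOfAut_mem_ofCMTypes_iff, mem_toCMTypes_iff]

/-- `toCMTypes` is injective on CM types of `K`. [cite: Milne1999, §6 p. 69 L22–L24] -/
theorem toCMTypes_injective {Φ Φ' : Set (K →ₐ[ℚ] cmNumbers)} (hΦ : IsCMTypeWith (cmNumbersConj : cmNumbers ≃ₐ[ℚ] cmNumbers) Φ)
    (hΦ' : IsCMTypeWith (cmNumbersConj : cmNumbers ≃ₐ[ℚ] cmNumbers) Φ') (e : toCMTypes τ₀ h hΦ = toCMTypes τ₀ h hΦ') : Φ = Φ' := by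
  rw [← ofCMTypes_toCMTypes τ₀ h hΦ, ← ofCMTypes_toCMTypes τ₀ h hΦ', e]

omit [IsCMField K] in
/-- Every `σ′ ∈ Gal(ℚ^{cm}/ℚ)` restricts to some `ρ ∈ Γ` along `τ₀` (`σ′ ∘ τ₀ = τ₀ ∘ ρ`, `K` Galois), and every `ρ` arises (`ℚ^{cm}/ℚ` normal).
[cite: Milne1999, §6 p. 69 L1 («Γ = Gal(K/ℚ)»)] -/
theorem exists_smul_eq_embOfAut (σ' : cmNumbers ≃ₐ[ℚ] cmNumbers) : ∃ ρ : K ≃ₐ[ℚ] K, σ' • τ₀ = embOfAut τ₀ ρ := by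
  obtain ⟨ρ, hρ⟩ := (autEquivEmb τ₀).surjective (σ' • τ₀)
  exact ⟨ρ, by rw [← hρ, autEquivEmb_apply]⟩

omit [IsCMField K] [IsGalois ℚ K] in
/-- [cite: Milne1999, §6 p. 69 L1 («Γ = Gal(K/ℚ)»)] -/
theorem exists_smul_eq_embOfAut' (ρ : K ≃ₐ[ℚ] K) : ∃ σ' : cmNumbers ≃ₐ[ℚ] cmNumbers, σ' • τ₀ = embOfAut τ₀ ρ :=
  exists_algEquiv_smul_eq τ₀ (embOfAut τ₀ ρ)

variable [DecidableEq (K ≃ₐ[ℚ] K)]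

omit [IsGalois ℚ K] in
/-- **Equivariance**: `Gal(ℚ^{cm}/ℚ)` acts on `Hom(K, ℚ^{cm}) = τ₀Γ` through `Γ` — if `σ′ ∘ τ₀ = τ₀ ∘ ρ` then `σ′ ∘ (τ₀δ) = τ₀ ∘ (ρδ)` — so `σ′Φ` read on
`Γ` is the translate `ρ·(Φ read on Γ)` («`Γ`-orbit of CM-types»: the orbits correspond). [cite: Milne1999, §6 p. 71 L15; §2 p. 55] -/
theorem toCMTypes_smul_set {Φ : Set (K →ₐ[ℚ] cmNumbers)} (hΦ : IsCMTypeWith (cmNumbersConj : cmNumbers ≃ₐ[ℚ] cmNumbers) Φ)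
    (σ' : cmNumbers ≃ₐ[ℚ] cmNumbers) (ρ : K ≃ₐ[ℚ] K) (hρ : σ' • τ₀ = embOfAut τ₀ ρ) :
    toCMTypes τ₀ h (isCMTypeWith_smul_set hΦ σ') = ρ • toCMTypes τ₀ h hΦ := by
  have key : ∀ δ : K ≃ₐ[ℚ] K, σ' • embOfAut τ₀ δ = embOfAut τ₀ (ρ * δ) := fun δ => by
    rw [embOfAut_mul, ← hρ]; rfl
  apply CosetGerm.CMTypes.ext h
  ext σ
  have e1 : σ'⁻¹ • embOfAut τ₀ σ = embOfAut τ₀ (ρ⁻¹ * σ) := by rw [inv_smul_eq_iff, key, mul_inv_cancel_left]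
  rw [mem_toCMTypes_iff, CosetGerm.CMTypes.mem_smul_iff, mem_toCMTypes_iff, Set.mem_smul_set_iff_inv_smul_mem, e1]

/-- **Orbits correspond**: `Φ′` lies in the `Gal(ℚ^{cm}/ℚ)`-orbit of `Φ` iff `Φ′` read on `Γ` lies in the `Γ`-orbit of `Φ` read on `Γ` («to each `Γ`-orbit
`Ψ` of CM-types»; Milne's `I = Γ\\{CM-types on K}` is the same set either way). [cite: Milne1999, §6 p. 71 L15; §5 p. 64 L-3] -/
theorem toCMTypes_mem_orbit_iff {Φ Φ' : Set (K →ₐ[ℚ] cmNumbers)} (hΦ : IsCMTypeWith (cmNumbersConj : cmNumbers ≃ₐ[ℚ] cmNumbers) Φ)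
    (hΦ' : IsCMTypeWith (cmNumbersConj : cmNumbers ≃ₐ[ℚ] cmNumbers) Φ') :
    toCMTypes τ₀ h hΦ' ∈ MulAction.orbit (K ≃ₐ[ℚ] K) (toCMTypes τ₀ h hΦ) ↔ Φ' ∈ MulAction.orbit (cmNumbers ≃ₐ[ℚ] cmNumbers) Φ := by
  constructor
  · rintro ⟨ρ, hρ⟩
    obtain ⟨σ', hσ'⟩ := exists_smul_eq_embOfAut' τ₀ ρ
    refine ⟨σ', ?_⟩
    have e : toCMTypes τ₀ h (isCMTypeWith_smul_set hΦ σ') = toCMTypes τ₀ h hΦ' := by rw [toCMTypes_smul_set τ₀ h hΦ σ' ρ hσ']; exact hρ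
    exact toCMTypes_injective τ₀ h _ _ e
  · rintro ⟨σ', rfl⟩
    obtain ⟨ρ, hρ⟩ := exists_smul_eq_embOfAut τ₀ σ'
    exact ⟨ρ, (toCMTypes_smul_set τ₀ h hΦ σ' ρ hρ).symm⟩

omit [DecidableEq (K ≃ₐ[ℚ] K)] in
/-- **`ψ_τ = λ_{Φ_τ}`**: g17-#2's `ψ_τ = τ + Σ_{τ′∈Γ₀, τ′≠τ} ιτ′ ∈ ℤ[Γ]` is the character of the CM type `Φ_τ = {τ₀τ} ∪ {τ₀ιτ′ | τ′ ∈ Γ₀, τ′ ≠ τ}` of `K`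
(= g17-#4's `τ·psiType` read on `Hom(K, ℚ^{cm})`) under `X^*(S^K) ↪ ℤ[Γ]`. [cite: Milne1999, §6 p. 69 L22–L24 («Let ψ_i = τ_i + Σ_{j≠i} ιτ_j …
ψ_0, …, ψ_{n−1}, ψ̄ form a basis for X^*(S^K)»)] -/
theorem toGroupRing_cmTypeChar_ofCMTypes (S : CMTypes h) :
    toGroupRing τ₀ (cmTypeChar (isCMTypeWith_ofCMTypes τ₀ h S) : (K →ₐ[ℚ] cmNumbers) → ℤ) = ind ℤ h S := by
  rw [toGroupRing_cmTypeChar τ₀ h, toCMTypes_ofCMTypes]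

/-- [cite: Milne1999, §6 p. 69 L22–L24] -/
theorem toGroupRing_cmTypeChar_psiType [DecidablePred (· ∈ Γ₀)] {τ : K ≃ₐ[ℚ] K} (hτ : τ ∈ Γ₀) :
    toGroupRing τ₀ (cmTypeChar (isCMTypeWith_ofCMTypes τ₀ h (τ • CosetGerm.psiType h)) : (K →ₐ[ℚ] cmNumbers) → ℤ) =
      CosetGerm.psi conjGal Γ₀ ℤ τ := by
  rw [toGroupRing_cmTypeChar_ofCMTypes, CosetGerm.ind_smul_psiType ℤ h hτ]

end Types

/-! ### §2 `π(Φ) ↦ f_{π(Φ)}`: the Weil germ of a CM type of `K` is the model's Weil germ of the CM type read on `Γ` -/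

section Germs

variable {K : Type} [Field K] [NumberField K] [IsCMField K] [IsGalois ℚ K] (Q : IntermediateField ℚ K)
variable (p : ℕ) [hp : Fact p.Prime] (𝔭 : Ideal (𝓞 K)) [h𝔭P : 𝔭.IsPrime] [h𝔭 : 𝔭.LiesOver (Ideal.span {(p : ℤ)})]
variable (τ₀ : K →ₐ[ℚ] cmNumbers)
variable {Γ₀ : Subgroup (K ≃ₐ[ℚ] K)} (h : Setting (conjGal : K ≃ₐ[ℚ] K) Γ₀ (decompositionGroup p 𝔭))
/-- `π(Φ) = alphaCharIn(λ_Φ)` as an element of `X^*(P^K) = W^K(p^∞)`: its underlying germ is g16-#6's `cmTypeGerm p 𝔭 Φ`.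
[cite: Milne1999, §5 p. 64 L-4 («sends CM-types on K to Weil integers of weight −1»)] -/
theorem coe_toMul_alphaCharIn_cmTypeChar {Φ : Set (K →ₐ[ℚ] cmNumbers)} (hΦ : IsCMTypeWith (cmNumbersConj : cmNumbers ≃ₐ[ℚ] cmNumbers) Φ) :
    ((Additive.toMul (alphaCharIn p 𝔭 τ₀ (cmTypeChar hΦ)) : weilLimitIn K p τ₀) : WeilLimit p) = cmTypeGerm p 𝔭 hΦ := by
  rw [coe_toMul_alphaCharIn, cmTypeGerm_def]

/-- **`f_{π(Φ)}` on `Γ/D` is the model's Weil germ `red(Φ) = push(ind Φ)`** (g17-#4 `CosetGerm.red`): the number-theoretic `π(Φ) ∈ W^K_{1,+}(p^∞)` and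
the model's `WeilGerms` agree under g18-#2's `π ↦ f_π : X^*(P^K) → ℤ[Γ/D]` (the commutative diagram applied to `λ_Φ`).
[cite: Milne1999, §6 p. 69 L18–L21, L26–L28 («Let π_i = π(ψ_{id}) ∈ W^K_{1,+}(p^∞) …»)] -/
theorem coe_red_toCMTypes {Φ : Set (K →ₐ[ℚ] cmNumbers)}
    (hΦ : IsCMTypeWith (cmNumbersConj : cmNumbers ≃ₐ[ℚ] cmNumbers) Φ) :
    (red ℤ h (toCMTypes τ₀ h hΦ)).1 = germToCosetFun p 𝔭 τ₀ (alphaCharIn p 𝔭 τ₀ (cmTypeChar hΦ)) := by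
  rw [CosetGerm.coe_red, ← toGroupRing_cmTypeChar τ₀ h hΦ, pushFun_toGroupRing]

/-- The same through `X^*(P^K) ≅ weilLattice` (g18-#2 `weilLatticeEquiv`). [cite: Milne1999, §6 p. 69 L18–L21, L26–L28] -/
theorem coe_weilLatticeEquiv_alphaCharIn_cmTypeChar {Φ : Set (K →ₐ[ℚ] cmNumbers)}
    (hΦ : IsCMTypeWith (cmNumbersConj : cmNumbers ≃ₐ[ℚ] cmNumbers) Φ) :
    (weilLatticeEquiv p 𝔭 τ₀ (alphaCharIn p 𝔭 τ₀ (cmTypeChar hΦ)) : (K ≃ₐ[ℚ] K) ⧸ decompositionGroup p 𝔭 →₀ ℤ) =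
      (red ℤ h (toCMTypes τ₀ h hΦ)).1 := by
  rw [coe_weilLatticeEquiv, coe_red_toCMTypes]

/-- **Every Weil germ of the model is an `f_{π(Φ)}`** for a CM type `Φ` of `K` (g17-#4 `red_surjective` + §1): the model's `X^*(L^Π)`-index sets are
orbits of actual `π(Φ) ∈ W^K_{1,+}(p^∞)`. [cite: Milne1999, §6 p. 69 L26–L28; §5 p. 64 L-3 («to each Γ-orbit Ψ of CM-types it attaches a Γ-orbit
Π(Ψ) of Weil integers»)] -/
theorem exists_cmTypeChar_of_weilGerms (w : WeilGerms ℤ h) :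
    ∃ (Φ : Set (K →ₐ[ℚ] cmNumbers)) (hΦ : IsCMTypeWith (cmNumbersConj : cmNumbers ≃ₐ[ℚ] cmNumbers) Φ),
      w.1 = germToCosetFun p 𝔭 τ₀ (alphaCharIn p 𝔭 τ₀ (cmTypeChar hΦ)) := by
  obtain ⟨S, rfl⟩ := CosetGerm.red_surjective ℤ h w
  exact ⟨ofCMTypes τ₀ h S, isCMTypeWith_ofCMTypes τ₀ h S, by rw [← coe_red_toCMTypes p 𝔭 τ₀ h, toCMTypes_ofCMTypes]⟩

end Germs

/-! ### §3 THEOREM 6.1 at level `K` on characters, with `X^*(S^K)`, `X^*(P^K)`, `X^*(α^K)` those of the CM field `K` -/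

section Theorem61

variable {K : Type} [Field K] [NumberField K] [IsCMField K] [IsGalois ℚ K] (Q : IntermediateField ℚ K)
variable (p : ℕ) [hp : Fact p.Prime] (𝔭 : Ideal (𝓞 K)) [h𝔭P : 𝔭.IsPrime] [h𝔭 : 𝔭.LiesOver (Ideal.span {(p : ℤ)})]
variable (τ₀ : K →ₐ[ℚ] cmNumbers)
variable [DecidableEq (K ≃ₐ[ℚ] K)] [DecidablePred (· ∈ Q.fixingSubgroup)] [DecidablePred (· ∈ decompositionGroup p 𝔭)]

omit hp in
/-- **THE RIGHT-HAND SQUARE FOR `Γ = Gal(K/ℚ)`, `D = D(w₀)` IS ALMOST CARTESIAN** — g17-#5 `int_isAlmostCartesian_pairProduct` at the number-theoretic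
`Setting` of g18-#1 (`K` CM Galois over `ℚ` with an imaginary quadratic subfield `Q` in which `p` splits): the square `X^*(T^K) → X^*(S^K)` over
`X^*(L^K) → X^*(P^K)` built on `Γ = Gal(K/ℚ) ⊇ Γ₀ = Gal(K/Q) ⊇ D(w₀)`. [cite: Milne1999, §6 p. 68 L-2 – p. 69 L9, p. 71 L22 – p. 72 L4 («Therefore the
right hand square is almost Cartesian, which completes the proof of Theorem 6.1»)] -/
theorem int_isAlmostCartesian_pairProduct_gal (hQ : Module.finrank ℚ Q = 2) (hQi : ¬IsTotallyReal Q)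
    (hsplit : ((Ideal.span {(p : ℤ)}).primesOver (𝓞 Q)).ncard = 2) :
    AlmostCartesian.IsAlmostCartesian (R := ℤ) (CosetGerm.alphaK ℤ (cosetGermSetting Q p 𝔭 hQ hQi hsplit))
      (CosetGerm.tKToS ℤ (cosetGermSetting Q p 𝔭 hQ hQi hsplit) two_ne_zero)
      (CosetGerm.lKToP ℤ (cosetGermSetting Q p 𝔭 hQ hQi hsplit) two_ne_zero)
      (alphaP (conjGal : K ≃ₐ[ℚ] K) (decompositionGroup p 𝔭) ℤ) :=
  CosetGerm.int_isAlmostCartesian_pairProduct (cosetGermSetting Q p 𝔭 hQ hQi hsplit)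

/-- **THEOREM 6.1 AT LEVEL `K` ON CHARACTERS, FOR THE CM FIELD `K` ITSELF** («`P^K = S^K ∩ L^K` (inside `T^K`), or, equivalently, … is exact»): with
`Γ = Gal(K/ℚ)`, `D = D(w₀)` as in g18-#1 and the identifications of g18-#2 (`X^*(S^K) = infinityTypes ≅ serreLattice`, `X^*(P^K) = W^K(p^∞) ≅
weilLattice`, `X^*(α^K) = alphaCharIn ↦ alphaP`), a pair `(y, g)` with `y ∈ X^*(L^K)` (the model's amalgamated product over the orbits of Weil germs,
all of which are orbits of actual `π(Φ)`'s by `exists_cmTypeChar_of_weilGerms`) and `g ∈ X^*(S^K)` OF THE FIELD `K` satisfies `β(y) = X^*(α^K)(g)` in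
`X^*(P^K) = W^K(p^∞)` OF THE FIELD `K` iff it comes from an `x ∈ X^*(T^K)` — g17-#5 `exact_pairProduct` transported along g18-#2.
[cite: Milne1999, §6 p. 66 L3–L4 (Theorem 6.1), L13–L17 («P^K = S^K ∩ L^K (inside T^K), or, equivalently, … is exact, for all sufficiently
large K»)] -/
theorem exact_pairProduct_gal (hQ : Module.finrank ℚ Q = 2) (hQi : ¬IsTotallyReal Q)
    (hsplit : ((Ideal.span {(p : ℤ)}).primesOver (𝓞 Q)).ncard = 2)
    (y : CosetGerm.LK ℤ (cosetGermSetting Q p 𝔭 hQ hQi hsplit))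
    (g : infinityTypes (cmNumbers ≃ₐ[ℚ] cmNumbers) (K →ₐ[ℚ] cmNumbers) cmNumbersConj) :
    CosetGerm.lKToP ℤ (cosetGermSetting Q p 𝔭 hQ hQi hsplit) two_ne_zero y = weilLatticeEquiv p 𝔭 τ₀ (alphaCharIn p 𝔭 τ₀ g) ↔
      ∃ x : CosetGerm.TK ℤ (cosetGermSetting Q p 𝔭 hQ hQi hsplit),
        CosetGerm.alphaK ℤ (cosetGermSetting Q p 𝔭 hQ hQi hsplit) x = y ∧
          CosetGerm.tKToS ℤ (cosetGermSetting Q p 𝔭 hQ hQi hsplit) two_ne_zero x = serreLatticeEquiv τ₀ g := by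
  rw [weilLatticeEquiv_alphaCharIn]
  exact CosetGerm.exact_pairProduct ℤ (cosetGermSetting Q p 𝔭 hQ hQi hsplit) two_ne_zero (by exact_mod_cast Fintype.card_ne_zero) y _

end Theorem61

end CMNumbers

end Literature.NumberTheory.ComplexMultiplication
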